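import Summits.HodgeConjecture.HodgeConjecture.Theorems.Q8QuaternionicTransvectionDensity
import Summits.HodgeConjecture.HodgeConjecture.Theorems.Q8CommutatorDegreeTwoCoreCayley
import Literature.AlgebraicGeometry.HodgeTheory.TensorStabilizerZariskiClosed
import Literature.NumberTheory.DiophantineGeometry.TensorWordModel
import HarnessLib

/-!
# Route `Q8SymplecticPowers`, programme K2Q ∕ F-Q — brick F1B: **a Zariski-closed subgroup containing the Cayley
# commutators of the quaternionic-unitary centraliser contains the whole centraliser**; coefficient tensors fixed by
# those commutators are fixed by the centraliser

Support file for crux K2Q `PowersHodgeOfQuaternionCommutators` (stmt-HodgeConjecture-24191; `--supports … --as helper`;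
nothing here closes an item). Prover seat `hodge-nonav-20241-p1` (g21). Pure linear algebra over a field `K` of
characteristic `0` containing `i` (`i² = −1`); the setting of the rung `Q8CommutatorDegreeTwoCore*`: `V` finite-dimensional,
`Q` symmetric non-degenerate, `a, b` `Q`-isometries with `a² = b² = −1`, `ab = −ba`, `M = ker (a − i)`, the
QUATERNIONIC-UNITARY CENTRALISER `Z = {g ∈ GL(V) : ga = ag, gb = bg, g ∈ O(Q)}`.

This is the «commutators ⇒ whole group» step of the all-powers stub `stub_higherPowersQ` (twin of route A's D₂
`CyclicUnitaryPowersDeckUnitaryCommutatorGeneration`, which used `SL_n ⊆ [GL_n, GL_n]`): here `Z ≅ Sp(M)` and the passage is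
* ENGINE-CAYLEY (`Q8CommutatorDegreeTwoCoreCayley.exists_q8Centraliser_cayley_commutator_eq_qtransvection`, p708176): every
  quaternionic transvection `x ↦ x + l Q(x, bv) v − l Q(x, v) bv`, `v ∈ M`, is a commutator `[g, h]` of two elements of `Z`
  with `det(1 + g)`, `det(1 + h)` units (the Cayley-parametrisable points reached by ASC-Q `commutator_invariance_ascends₂`);
* the QUATERNIONIC LEMMA T (`Q8QuaternionicTransvectionDensity.mem_glZariskiClosure_of_quaternionic`, p706267, Deligne
  Weil II 4.4): a subgroup containing a non-trivial transvection along every `v ∈ R`, `R ⊆ M` spanning and ω-connected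
  (`ω(x, y) = Q(x, by)`), has every element of `Z` in its Zariski closure — applied with `R = M ∖ {0}`, which spans `M`
  trivially and is ω-connected because `ω` is non-degenerate on `M` (`exists_hyperbolic_partner`, p705032);
* Zariski-closedness of stabilisers of coefficient tensors (`IsMatrixPolynomial`, `TensorStabilizerZariskiClosed` §1).

Results:
* `isConnected_eigen` — `M ∖ {0}` is ω-orthogonally connected;
* **`mem_of_cayley_commutators_mem`** — a subgroup `Γ ≤ GL(V)` with `glZariskiClosure Γ ⊆ Γ` containing `[g, h]` for all
  Cayley pairs `g, h ∈ Z` contains `Z`;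
* **`tensorPowerMatrix_mulVec_eq_of_cayley_commutators`** — for a basis `β : Fin n` of `V` and a coefficient tensor
  `c : (Fin m → Fin n) → K`: if `[ghg⁻¹h⁻¹]_β^{⊗m} c = c` (Kronecker power `tensorPowerMatrix`) for all Cayley pairs of `Z`,
  then `[z]_β^{⊗m} c = c` for every `z ∈ Z`.

HONEST FRAMING: linear algebra only (axioms standard); item 24191 OPEN; nothing here says HC ∕ HC_CM ∕ HC_AV is proved.

## References

* P. Deligne, *La conjecture de Weil II*, Publ. Math. IHÉS 52 (1980), §4.4 Lemme (4.4.2^α)–(4.4.4^α). [cite: Deligne1980]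
* R. Goodman, N. Wallach, *Symmetry, Representations, and Invariants*, GTM 255, §2.2.3 Exercise 1 (Cayley parameters),
  §1.4.5 Exercise 5. [cite: GoodmanWallachGTM255]
* J. Carlson, S. Müller-Stach, C. Peters, *Period Mappings and Period Domains* (2nd ed.), Lemma–Definition 15.3.7,
  Theorem 15.2.9. [cite: CarlsonMullerStachPeters2017]
-/

set_option linter.dupNamespace false

noncomputable section

open Module
open scoped BigOperators Matrix

namespace Summit.HodgeConjecture.HodgeConjecture.Theorems.Q8SymplecticPowersCentraliserInvariance

open Literature.AlgebraicGeometry.Motives Literature.AlgebraicGeometry.HodgeTheory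
open Summit.HodgeConjecture.HodgeConjecture.Theorems.Q8CommutatorDegreeTwoCore
open Summit.HodgeConjecture.HodgeConjecture.Theorems.Q8CommutatorDegreeTwoCoreCayley
open Summit.HodgeConjecture.HodgeConjecture.Theorems.Q8QuaternionicTransvectionDensity

universe u v

variable {K : Type u} [Field K] {V : Type v} [AddCommGroup V] [Module K V]
  {Q : LinearMap.BilinForm K V} {a b : V →ₗ[K] V} {i : K}

/-! ### §1 `M ∖ {0}` spans `M` and is ω-orthogonally connected -/

/-- `M ∖ {0}` spans `M`. [folklore] -/
theorem mem_span_eigen_ne_zero (m : V) (hm : a m = i • m) :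
    m ∈ Submodule.span K {v : V | a v = i • v ∧ v ≠ 0} := by
  by_cases h0 : m = 0
  · rw [h0]; exact Submodule.zero_mem _
  · exact Submodule.subset_span ⟨hm, h0⟩

/-- **`M ∖ {0}` is ω-orthogonally connected** (`ω(x, y) = Q(x, by)` is non-degenerate on `M = ker (a − i)` by
`exists_hyperbolic_partner`): a non-empty proper `A ⊆ M ∖ {0}` has some `r ∈ A` and `ρ ∈ (M ∖ {0}) ∖ A` with
`Q r (b ρ) ≠ 0`. [cite: Deligne1980, §4.4 (4.4.4^α)] -/
theorem isConnected_eigen [CharZero K] (hQs : ∀ x y, Q x y = Q y x) (hQn : Q.Nondegenerate)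
    (haa : ∀ x, a (a x) = -x) (hbb : ∀ x, b (b x) = -x) (hab : ∀ x, a (b x) = -b (a x))
    (haQ : ∀ x y, Q (a x) (a y) = Q x y) (hQb : ∀ x y, Q (b x) (b y) = Q x y) (hi : i * i = -1) :
    ∀ A ⊆ {v : V | a v = i • v ∧ v ≠ 0}, A.Nonempty → A ≠ {v : V | a v = i • v ∧ v ≠ 0} →
      ∃ r ∈ A, ∃ ρ ∈ {v : V | a v = i • v ∧ v ≠ 0}, ρ ∉ A ∧ Q r (b ρ) ≠ 0 := by
  intro A hAR hAne hAR'
  by_contra hcon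
  push Not at hcon
  -- `ω(r, ρ) = 0` for `r ∈ A`, `ρ ∈ R ∖ A`
  obtain ⟨r, hr⟩ := hAne
  obtain ⟨ρ, hρR, hρA⟩ : ∃ ρ ∈ {v : V | a v = i • v ∧ v ≠ 0}, ρ ∉ A := by
    by_contra h
    push Not at h
    exact hAR' (Set.Subset.antisymm hAR h)
  have hrR := hAR hr
  -- `ω` is skew on `M`: `Q x (b y) = -Q y (b x)`
  have hskew : ∀ x y : V, Q x (b y) = -Q y (b x) := fun x y => by
    have h := hQb x (b y)
    rw [hbb, map_neg] at h
    rw [← h, hQs (b x) y]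
  -- a vector of `M` that is ω-orthogonal to `A` and to `R ∖ A` vanishes
  have hzero : ∀ m : V, a m = i • m → (∀ x ∈ A, Q m (b x) = 0) →
      (∀ y ∈ {v : V | a v = i • v ∧ v ≠ 0}, y ∉ A → Q m (b y) = 0) → m = 0 := by
    intro m hm hA hB
    by_contra hm0
    obtain ⟨w, hw, hmw⟩ := exists_hyperbolic_partner hQs hQn haa hbb hab haQ hi hm0 hm
    have hw0 : w ≠ 0 := by
      rintro rfl
      rw [map_zero, map_zero] at hmw
      exact zero_ne_one hmw
    by_cases hwA : w ∈ A
    · rw [hA w hwA] at hmw; exact zero_ne_one hmw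
    · rw [hB w ⟨hw, hw0⟩ hwA] at hmw; exact zero_ne_one hmw
  -- the vector `r + ρ ∈ M`
  have hsum : a (r + ρ) = i • (r + ρ) := by rw [map_add, hrR.1, hρR.1, smul_add]
  by_cases hv0 : r + ρ = 0
  · -- `ρ = -r`: then `r` is orthogonal to everything
    have hρr : ρ = -r := eq_neg_of_add_eq_zero_right hv0
    refine hrR.2 (hzero r hrR.1 (fun x hx => ?_) (fun y hy hyA => hcon r hr y hy hyA))
    have h1 := hcon x hx ρ hρR hρA
    rw [hρr, map_neg, map_neg, neg_eq_zero] at h1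
    rw [hskew, h1, neg_zero]
  · by_cases hvA : r + ρ ∈ A
    · -- then `ρ` is orthogonal to everything
      refine hρR.2 (hzero ρ hρR.1 (fun x hx => ?_) (fun y hy hyA => ?_))
      · have h1 := hcon x hx ρ hρR hρA
        rw [hskew, h1, neg_zero]
      · have h1 := hcon _ hvA y hy hyA
        have h2 := hcon r hr y hy hyA
        rw [map_add, LinearMap.add_apply, h2, zero_add] at h1
        exact h1
    · -- then `r` is orthogonal to everything
      refine hrR.2 (hzero r hrR.1 (fun x hx => ?_) (fun y hy hyA => hcon r hr y hy hyA))
      have h1 := hcon x hx (r + ρ) ⟨hsum, hv0⟩ hvA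
      have h2 := hcon x hx ρ hρR hρA
      rw [map_add, map_add, h2, add_zero] at h1
      rw [hskew, h1, neg_zero]

/-! ### §2 A Zariski-closed subgroup containing the Cayley commutators of `Z` contains `Z` -/

/-- **A subgroup `Γ ≤ GL(V)` closed on `K`-points (`glZariskiClosure Γ ⊆ Γ`) and containing the commutator `[g, h]` of
every pair of Cayley-parametrisable elements `g, h` of the quaternionic-unitary centraliser `Z` (`det(1 + g)`, `det(1 + h)`
units) contains `Z`**: every quaternionic transvection along `v ∈ M` is such a commutator (ENGINE-CAYLEY), `M ∖ {0}` spans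
`M` and is ω-connected, and the quaternionic Lemma T puts `Z` into the Zariski closure of `Γ`.
[cite: Deligne1980, §4.4 Lemme (4.4.2^α)–(4.4.4^α)] [cite: GoodmanWallachGTM255, §2.2.3 Exercise 1] -/
theorem mem_of_cayley_commutators_mem [CharZero K] [Module.Finite K V]
    (hQs : ∀ x y, Q x y = Q y x) (hQn : Q.Nondegenerate)
    (haa : ∀ x, a (a x) = -x) (hbb : ∀ x, b (b x) = -x) (hab : ∀ x, a (b x) = -b (a x))
    (haQ : ∀ x y, Q (a x) (a y) = Q x y) (hQb : ∀ x y, Q (b x) (b y) = Q x y) (hi : i * i = -1)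
    {Γ : Subgroup (V ≃ₗ[K] V)} (hΓcl : glZariskiClosure Γ ⊆ (Γ : Set (V ≃ₗ[K] V)))
    (hΓ : ∀ g h : V ≃ₗ[K] V, (∀ x, g (a x) = a (g x)) → (∀ x, g (b x) = b (g x)) →
      (∀ x y, Q (g x) (g y) = Q x y) → (∀ x, h (a x) = a (h x)) → (∀ x, h (b x) = b (h x)) →
      (∀ x y, Q (h x) (h y) = Q x y) →
      IsUnit (LinearMap.det ((g : V →ₗ[K] V) + 1)) → IsUnit (LinearMap.det ((h : V →ₗ[K] V) + 1)) →
      g * h * g⁻¹ * h⁻¹ ∈ Γ)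
    {z : V ≃ₗ[K] V} (hza : ∀ x, z (a x) = a (z x)) (hzb : ∀ x, z (b x) = b (z x))
    (hzQ : ∀ x y, Q (z x) (z y) = Q x y) : z ∈ Γ := by
  refine hΓcl (mem_glZariskiClosure_of_quaternionic hQs hQn haa hbb hab haQ hQb hi (R := {v : V | a v = i • v ∧ v ≠ 0})
    (fun v hv => hv.1) (fun m hm => mem_span_eigen_ne_zero m hm) (isConnected_eigen hQs hQn haa hbb hab haQ hQb hi)
    (fun v hv => ?_) hza hzb hzQ)
  obtain ⟨g, h, ⟨hg1, hg2, hg3⟩, ⟨hh1, hh2, hh3⟩, hg4, hh4, hgh⟩ :=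
    exists_q8Centraliser_cayley_commutator_eq_qtransvection hQs hQn a b haa hbb hab haQ hQb hi hv.1 (1 : K)
  exact ⟨1, one_ne_zero, g * h * g⁻¹ * h⁻¹, hΓ g h hg1 hg2 hg3 hh1 hh2 hh3 hg4 hh4, hgh⟩

/-! ### §3 Coefficient tensors: fixed by the Cayley commutators ⇒ fixed by `Z` -/

section Tensor

open Literature.NumberTheory.DiophantineGeometry (tensorPowerMatrix tensorPowerMatrix_apply tensorPowerMatrix_mul
  tensorPowerMatrix_one)

variable {n : ℕ} (β : Module.Basis (Fin n) K V) {m : ℕ}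

/-- Matrices of products of automorphisms. [folklore] -/
theorem toMatrix_mul_equiv (g h : V ≃ₗ[K] V) :
    LinearMap.toMatrix β β ((g * h : V ≃ₗ[K] V) : V →ₗ[K] V) =
      LinearMap.toMatrix β β (g : V →ₗ[K] V) * LinearMap.toMatrix β β (h : V →ₗ[K] V) := by
  rw [← LinearMap.toMatrix_mul]
  rfl

/-- The matrix of the identity automorphism. [folklore] -/
theorem toMatrix_one_equiv : LinearMap.toMatrix β β ((1 : V ≃ₗ[K] V) : V →ₗ[K] V) = 1 := by
  rw [show ((1 : V ≃ₗ[K] V) : V →ₗ[K] V) = LinearMap.id from rfl, LinearMap.toMatrix_id]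

/-- **The stabiliser of a coefficient tensor** `c : (Fin m → Fin n) → K` under `g ↦ [g]_β^{⊗m}` (the coordinates of `g^{⊗m}` on
`Σ_w c(w) ⊗_p β (w p)`), as a subgroup of `GL(V)` (inline construction). [cite: CarlsonMullerStachPeters2017, Theorem 15.2.9] -/
theorem exists_stabilizer_subgroup (c : (Fin m → Fin n) → K) :
    ∃ Γ : Subgroup (V ≃ₗ[K] V), ∀ g : V ≃ₗ[K] V,
      g ∈ Γ ↔ tensorPowerMatrix K n m (LinearMap.toMatrix β β (g : V →ₗ[K] V)) *ᵥ c = c := by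
  refine ⟨{ carrier := {g | tensorPowerMatrix K n m (LinearMap.toMatrix β β (g : V →ₗ[K] V)) *ᵥ c = c}
            mul_mem' := ?_
            one_mem' := ?_
            inv_mem' := ?_ }, fun g => Iff.rfl⟩
  · intro g h hg hh
    simp only [Set.mem_setOf_eq] at hg hh ⊢
    rw [toMatrix_mul_equiv, tensorPowerMatrix_mul, ← Matrix.mulVec_mulVec, hh, hg]
  · simp only [Set.mem_setOf_eq]
    rw [toMatrix_one_equiv, tensorPowerMatrix_one, Matrix.one_mulVec]
  · intro g hg
    simp only [Set.mem_setOf_eq] at hg ⊢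
    have hinv : tensorPowerMatrix K n m (LinearMap.toMatrix β β ((g⁻¹ : V ≃ₗ[K] V) : V →ₗ[K] V)) *
        tensorPowerMatrix K n m (LinearMap.toMatrix β β (g : V →ₗ[K] V)) = 1 := by
      rw [← tensorPowerMatrix_mul, ← toMatrix_mul_equiv, inv_mul_cancel, toMatrix_one_equiv, tensorPowerMatrix_one]
    conv_lhs => rw [← hg, Matrix.mulVec_mulVec, hinv, Matrix.one_mulVec]

/-- **The stabiliser of a coefficient tensor is Zariski closed** (each coordinate of `[g]_β^{⊗m} c − c` is a polynomial in the
matrix entries of `g`). [cite: CarlsonMullerStachPeters2017, Theorem 15.2.9 and Lemma–Definition 15.3.7] -/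
theorem glZariskiClosure_stabilizer_subset [Module.Finite K V] (c : (Fin m → Fin n) → K) {Γ : Subgroup (V ≃ₗ[K] V)}
    (hΓ : ∀ g : V ≃ₗ[K] V, g ∈ Γ ↔ tensorPowerMatrix K n m (LinearMap.toMatrix β β (g : V →ₗ[K] V)) *ᵥ c = c) :
    glZariskiClosure Γ ⊆ (Γ : Set (V ≃ₗ[K] V)) := by
  classical
  intro g hg
  rw [SetLike.mem_coe, hΓ]
  funext w'
  rw [mem_glZariskiClosure_iff, ← zariskiClosureEnd_basis_indep β] at hg
  -- the polynomial `f ↦ Σ_w (∏_p [f]_β (w' p) (w p)) c(w) − c(w')`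
  have hφ : IsMatrixPolynomial β fun f : Module.End K V =>
      (∑ w, (∏ p, LinearMap.toMatrix β β f (w' p) (w p)) * c w) - c w' :=
    (IsMatrixPolynomial.sum Finset.univ fun w _ =>
      (IsMatrixPolynomial.prod Finset.univ fun p _ => IsMatrixPolynomial.entry β (w' p) (w p)).mul
        (IsMatrixPolynomial.const β (c w))).sub (IsMatrixPolynomial.const β (c w'))
  have hval : ∀ f : Module.End K V, (tensorPowerMatrix K n m (LinearMap.toMatrix β β f) *ᵥ c) w' =
      ∑ w, (∏ p, LinearMap.toMatrix β β f (w' p) (w p)) * c w := fun f => by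
    rw [Matrix.mulVec, dotProduct]
    rfl
  have h0 := hφ.eq_zero_of_mem_zariskiClosureEndOfBasis (S := (fun h : V ≃ₗ[K] V => (h : Module.End K V)) ''
    (Γ : Set (V ≃ₗ[K] V))) ?_ hg
  · rw [hval]; exact sub_eq_zero.1 h0
  · rintro _ ⟨h, hh, rfl⟩
    have hh' := congr_fun ((hΓ h).1 hh) w'
    rw [hval] at hh'
    exact sub_eq_zero.2 hh'

/-- **Coefficient tensors fixed by the Cayley commutators of the quaternionic-unitary centraliser `Z` are fixed by `Z`.**
For a basis `β` of `V` and `c : (Fin m → Fin n) → K`: if `[ghg⁻¹h⁻¹]_β^{⊗m} c = c` for all `g, h ∈ Z` with `det(1 + g)`,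
`det(1 + h)` units, then `[z]_β^{⊗m} c = c` for every `z ∈ Z`.
[cite: Deligne1980, §4.4 Lemme (4.4.2^α)–(4.4.4^α)] [cite: GoodmanWallachGTM255, §2.2.3 Exercise 1 and §5.3.2]
[cite: CarlsonMullerStachPeters2017, Theorem 15.2.9] -/
theorem tensorPowerMatrix_mulVec_eq_of_cayley_commutators [CharZero K] [Module.Finite K V]
    (hQs : ∀ x y, Q x y = Q y x) (hQn : Q.Nondegenerate)
    (haa : ∀ x, a (a x) = -x) (hbb : ∀ x, b (b x) = -x) (hab : ∀ x, a (b x) = -b (a x))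
    (haQ : ∀ x y, Q (a x) (a y) = Q x y) (hQb : ∀ x y, Q (b x) (b y) = Q x y) (hi : i * i = -1)
    (c : (Fin m → Fin n) → K)
    (hc : ∀ g h : V ≃ₗ[K] V, (∀ x, g (a x) = a (g x)) → (∀ x, g (b x) = b (g x)) →
      (∀ x y, Q (g x) (g y) = Q x y) → (∀ x, h (a x) = a (h x)) → (∀ x, h (b x) = b (h x)) →
      (∀ x y, Q (h x) (h y) = Q x y) →
      IsUnit (LinearMap.det ((g : V →ₗ[K] V) + 1)) → IsUnit (LinearMap.det ((h : V →ₗ[K] V) + 1)) →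
      tensorPowerMatrix K n m (LinearMap.toMatrix β β ((g * h * g⁻¹ * h⁻¹ : V ≃ₗ[K] V) : V →ₗ[K] V)) *ᵥ c = c)
    {z : V ≃ₗ[K] V} (hza : ∀ x, z (a x) = a (z x)) (hzb : ∀ x, z (b x) = b (z x))
    (hzQ : ∀ x y, Q (z x) (z y) = Q x y) :
    tensorPowerMatrix K n m (LinearMap.toMatrix β β (z : V →ₗ[K] V)) *ᵥ c = c := by
  obtain ⟨Γ, hΓ⟩ := exists_stabilizer_subgroup β c
  exact (hΓ z).1 (mem_of_cayley_commutators_mem hQs hQn haa hbb hab haQ hQb hi (glZariskiClosure_stabilizer_subset β c hΓ)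
    (fun g h hg1 hg2 hg3 hh1 hh2 hh3 hg4 hh4 => (hΓ _).2 (hc g h hg1 hg2 hg3 hh1 hh2 hh3 hg4 hh4)) hza hzb hzQ)

end Tensor

end Summit.HodgeConjecture.HodgeConjecture.Theorems.Q8SymplecticPowersCentraliserInvariance

end
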